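import Summits.BirchSwinnertonDyer.BirchSwinnertonDyer.Theorems.PrintCFramBottomClassIndexLawFiveLeFlipRungTwoFlipIdentity
import Summits.BirchSwinnertonDyer.BirchSwinnertonDyer.Theorems.PrintCFramBottomClassIndexLawFiveLeFlipRungTwoJunkPeriod
import Summits.BirchSwinnertonDyer.BirchSwinnertonDyer.Theorems.PrintCFramBottomClassIndexLawFiveLeFlipRungTwoJunk
import Literature.NumberTheory.EllipticCurves.HalfIntegralWeightClassProjection
import HarnessLib

/-!
# Crux `PrintCFram.BottomClassIndexLawFiveLe` (stmt-BirchSwinnertonDyer-20372), line `eisenstein-resource-bdp-line` (registry v29 `stub_flipRungs.2`):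
# THE 2-ADIC FLIPPED-CUSP RUNG, modular assembly piece (A2) — THE BRACKET AT THE FLIPPED CUSP IS `8^{−(k+1)}·(ODD + JUNK)`, AND ITS
# COEFFICIENTS AT THE FREQUENCIES `4 ∤ n` ARE THE FLIP WEIGHTS TIMES `b(n)`
# (cell `bsd-print-cfram`, width seat `bsd-line-cfram-p1-w7` g9; THEOREMS ONLY, `--supports` 20372 `--as helper`; BSD is not proved by any of this)

HONEST FRAMING. Nothing here is a statement about BSD, elliptic curves or Bernoulli numbers; no registered stub is closed. Piece (A2) of the
modular assembly `jmlTwo_six_of_facts` (crux notes w7g8-T6 §5c–§5d; w5 g8 HOME/STATUS 2026-08-29T11:06:24Z item (ii)). Data: `γ₀ = [[a,b],[M,64]]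
∈ SL₂(ℤ)` (`64a − Mb = 1`, `0 ≤ a`), `g` automorphic of weight `(2k+1)/2` on `Γ₀(4M)` (character `ψ`) with `q`-expansion `b`, a class `c mod 8`,
and w5 g8's BRACKET `B(z) = 8^{−(k+1)}·(P_c g)(γ₀•z)·(√((Mz+64)/8)^{2k+1})⁻¹` of the Katz vehicle `(P_c g)·θ` at the flipped cusp
(`…FlipRungTwoBracket`), read in the variable `w`, `z = 64•w` (base `(M·64w+64)/8 = 8(Mw+1)` = P1's base):

  `B(64•w) = 8^{−(k+1)}·[ Σ_{j odd} ω_j g(j/8 +ᵥ γ₀•64w) + Σ_{j even} ω_j g(j/8 +ᵥ γ₀•64w) ]·(√(8(Mw+1))^{2k+1})⁻¹`,  `ω_j = ⅛ζ₈^{−cj}`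
  (`classProj_apply`); the ODD part is `Σ_n W_c(n) b(n) e(nw)` (P1 `hasSum_oddPart_flippedCusp_of_det`, `W_c(n)` = the raw flip-weight sum
  `Σ_{j∈{1,3,5,7}} ω_j ψ(d_j)(ε_{d_j}⁻¹ J(8M|d_j))^{2k+1} e(−jn/8)`), the EVEN part is `¼`-periodic in `w` (P3 `evenTranslate_flippedCusp_periodic`).
  Hence (w5 g8's generic `coeff_eq_of_periodic_junk` with `H = N/64`, period `¼`): if `B = Σ_m c_B(m) 𝕢_N^m` then for every `n` with `4 ∤ n`
  **`c_B(n·N/64) = 8^{−(k+1)}·W_c(n)·b(n)`** (`64 ∣ N`).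

* §1 bookkeeping: `sum_range_eight_split`, the base `(M·(64•w)+64)/8 = 8(Mw+1)`, `𝕢_N(64•w) = 𝕢_{N/64}(w)`, `𝕢₁(w)^n = 𝕢_{N/64}(w)^{n·N/64}`;
* §2 `hasSum_main_qParam` — the ODD part divided by the base, as a `𝕢_{N/64}`-series supported on the multiples of `N/64`;
* §3 `junk_vadd_quarter` — the EVEN part divided by the base is `¼`-periodic; §4 **`bracket_coeff_eq_flipWeight_mul`** — the displayed identity.

No definitions, no named facts, no `sorry`. beyond-print theorem: NO. References: [Shimura1973HalfIntegral] §1, Prop. 1.5; [DiamondShurman2005] §1.1;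
crux notes w7g8-T6 §1c, §5c–§5d.
-/

set_option autoImplicit false
-- summit-side namespace `Summit.BirchSwinnertonDyer.BirchSwinnertonDyer.…` (single-conjunct summit, D-0017 layout)
set_option linter.dupNamespace false

noncomputable section

open UpperHalfPlane hiding I
open Complex CongruenceSubgroup Function
open scoped MatrixGroups Real NumberTheorySymbols
open Literature.NumberTheory.EllipticCurves.ModularForms
open Literature.NumberTheory.EllipticCurves.Tunnell1983 (zeta8 classProj classProj_apply)

namespace Summit.BirchSwinnertonDyer.BirchSwinnertonDyer.Theorems.PrintCFram.FlipRung

/-! ## §1 Bookkeeping -/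

/-- `Σ_{j<8} F(j) = Σ_{j∈{1,3,5,7}} F(j) + Σ_{j₁<4} F(2j₁)`. [folklore] -/
theorem sum_range_eight_split (F : ℕ → ℂ) :
    ∑ j ∈ Finset.range 8, F j = ∑ j ∈ ({1, 3, 5, 7} : Finset ℕ), F j + ∑ j₁ ∈ Finset.range 4, F (2 * j₁) := by
  simp [Finset.sum_range_succ, Finset.sum_insert, Finset.sum_singleton]
  ring

/-- The dilation: `((64•w : ℍ) : ℂ) = 64·w`. [folklore] -/
theorem coe_sixtyfour_smul (w : ℍ) : ((((⟨64, by norm_num⟩ : {x : ℝ // 0 < x}) • w : ℍ)) : ℂ) = 64 * (w : ℂ) := by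
  rw [coe_pos_real_smul]; simp [Complex.real_smul]

/-- The base of the bracket at `z = 64•w` is P1's base: `(M·(64w) + 64)/8 = 8(Mw + 1)`. [folklore] -/
theorem bracketBase_dilate (M : ℂ) (w : ℍ) :
    (M * ((((⟨64, by norm_num⟩ : {x : ℝ // 0 < x}) • w : ℍ)) : ℂ) + 64) / 8 = 8 * (M * w + 1) := by
  rw [coe_sixtyfour_smul]; ring

/-- `𝕢_N(64•w) = 𝕢_{N/64}(w)` for `64 ∣ N`. [folklore] -/
theorem qParam_dilate_eq {N : ℕ} (hN : 64 ∣ N) (w : ℍ) :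
    Periodic.qParam (N : ℝ) ((((⟨64, by norm_num⟩ : {x : ℝ // 0 < x}) • w : ℍ)) : ℂ) = Periodic.qParam ((N / 64 : ℕ) : ℝ) (w : ℂ) := by
  obtain ⟨N₁, rfl⟩ := hN
  have h : (64 * N₁) / 64 = N₁ := by omega
  rw [h, coe_sixtyfour_smul]
  simp only [Periodic.qParam]
  congr 1
  push_cast
  rcases Nat.eq_zero_or_pos N₁ with h0 | hpos
  · subst h0; simp
  · have : (N₁ : ℂ) ≠ 0 := by exact_mod_cast hpos.ne'
    field_simp

/-- `𝕢₁(w)^n = 𝕢_{N₁}(w)^{n·N₁}` (`N₁ ≥ 1`). [folklore] -/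
theorem qParam_one_pow_eq_qParam_pow_mul {N₁ : ℕ} (hN₁ : 0 < N₁) (w : ℍ) (n : ℕ) :
    Periodic.qParam 1 (w : ℂ) ^ n = Periodic.qParam (N₁ : ℝ) (w : ℂ) ^ (n * N₁) := by
  simp only [Periodic.qParam, ← Complex.exp_nat_mul]
  congr 1
  have : (N₁ : ℂ) ≠ 0 := by exact_mod_cast hN₁.ne'
  push_cast
  field_simp

/-! ## §2 The ODD part divided by the base, as a `𝕢_{N/64}`-series -/

/-- **THE MAIN TERM.** With P1's `hasSum_oddPart_flippedCusp_of_det`: for `N₁ ≥ 1`,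
`8^{−(k+1)}·(Σ_{j odd} ω_j g(j/8 +ᵥ γ₀•64w))·(√(8(Mw+1))^{2k+1})⁻¹ = Σ_K m(K) 𝕢_{N₁}(w)^K` with `m(n·N₁) = 8^{−(k+1)} W_c(n) b(n)` and `m = 0` off
the multiples of `N₁`. [cite: Shimura1973HalfIntegral, Prop. 1.5] -/
theorem hasSum_main_qParam {M : ℕ} {a b : ℤ} (hdet : 64 * a - (M : ℤ) * b = 1) (γ₀ : SL(2, ℤ))
    (h00 : (γ₀ 0 0 : ℤ) = a) (h01 : (γ₀ 0 1 : ℤ) = b) (h10 : (γ₀ 1 0 : ℤ) = M) (h11 : (γ₀ 1 1 : ℤ) = 64)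
    {k : ℕ} {ψ : DirichletCharacter ℂ (4 * M)} {g : ℍ → ℂ}
    (hg : ∀ γ ∈ Gamma0 (4 * M), ∀ z : ℍ, g (γ • z) = autFactor (2 * k + 1) (4 * M) ψ γ z * g z)
    (ω : ℕ → ℂ) {b' : ℕ → ℂ} (hb : ∀ τ : ℍ, HasSum (fun n ↦ b' n * Periodic.qParam 1 (τ : ℂ) ^ n) (g τ))
    {N₁ : ℕ} (hN₁ : 0 < N₁) (w : ℍ) :
    HasSum (fun K : ℕ ↦ (if N₁ ∣ K then ((8 : ℂ)⁻¹) ^ (k + 1) *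
        (∑ j ∈ ({1, 3, 5, 7} : Finset ℕ), ω j * (ψ (((8 + (M : ℤ) * (j : ℤ) : ℤ)) : ZMod (4 * M)) *
          ((thetaEps (8 + (M : ℤ) * (j : ℤ)))⁻¹ * (J(8 * (M : ℤ) | (8 + (M : ℤ) * (j : ℤ)).natAbs) : ℂ)) ^ (2 * k + 1)) *
            cexp (-(2 * π * Complex.I * ((j * (K / N₁) : ℕ) : ℂ) / 8))) * b' (K / N₁) else 0) *
        Periodic.qParam (N₁ : ℝ) (w : ℂ) ^ K)
      (((8 : ℂ)⁻¹) ^ (k + 1) * (∑ j ∈ ({1, 3, 5, 7} : Finset ℕ), ω j *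
          g ((((j : ℝ) / 8) +ᵥ γ₀ • ((⟨64, by norm_num⟩ : {x : ℝ // 0 < x}) • w) : ℍ))) *
        (Complex.sqrt (8 * ((M : ℂ) * w + 1)) ^ (2 * k + 1))⁻¹) := by
  have hbase : (M : ℂ) * w + 1 ≠ 0 := by
    rcases Nat.eq_zero_or_pos M with hM | hM
    · subst hM; simp
    · intro h0
      have h := congrArg Complex.im h0
      simp at h
      rcases h with h | h
      · omega
      · exact absurd h w.im_pos.ne'
  have hbase8 : (8 : ℂ) * ((M : ℂ) * w + 1) ≠ 0 := mul_ne_zero (by norm_num) hbase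
  have hsq : Complex.sqrt (8 * ((M : ℂ) * w + 1)) ^ (2 * k + 1) ≠ 0 := by
    refine pow_ne_zero _ (fun h0 ↦ hbase8 ?_)
    rw [← csqrt_sq (8 * ((M : ℂ) * w + 1)), h0]
    ring
  have h1 := (hasSum_oddPart_flippedCusp_of_det hdet γ₀ h00 h01 h10 h11 hg ω hb w).mul_left
    (((8 : ℂ)⁻¹) ^ (k + 1) * (Complex.sqrt (8 * ((M : ℂ) * w + 1)) ^ (2 * k + 1))⁻¹)
  have hval : ((8 : ℂ)⁻¹) ^ (k + 1) * (Complex.sqrt (8 * ((M : ℂ) * w + 1)) ^ (2 * k + 1))⁻¹ *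
      (∑ j ∈ ({1, 3, 5, 7} : Finset ℕ), ω j * g ((((j : ℝ) / 8) +ᵥ γ₀ • ((⟨64, by norm_num⟩ : {x : ℝ // 0 < x}) • w) : ℍ))) =
      ((8 : ℂ)⁻¹) ^ (k + 1) * (∑ j ∈ ({1, 3, 5, 7} : Finset ℕ), ω j *
          g ((((j : ℝ) / 8) +ᵥ γ₀ • ((⟨64, by norm_num⟩ : {x : ℝ // 0 < x}) • w) : ℍ))) *
        (Complex.sqrt (8 * ((M : ℂ) * w + 1)) ^ (2 * k + 1))⁻¹ := by ring
  rw [hval] at h1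
  have h2 : HasSum (fun n : ℕ ↦ (((8 : ℂ)⁻¹) ^ (k + 1) *
      (∑ j ∈ ({1, 3, 5, 7} : Finset ℕ), ω j * (ψ (((8 + (M : ℤ) * (j : ℤ) : ℤ)) : ZMod (4 * M)) *
        ((thetaEps (8 + (M : ℤ) * (j : ℤ)))⁻¹ * (J(8 * (M : ℤ) | (8 + (M : ℤ) * (j : ℤ)).natAbs) : ℂ)) ^ (2 * k + 1)) *
          cexp (-(2 * π * Complex.I * ((j * n : ℕ) : ℂ) / 8))) * b' n) * Periodic.qParam (N₁ : ℝ) (w : ℂ) ^ (n * N₁))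
      (((8 : ℂ)⁻¹) ^ (k + 1) * (∑ j ∈ ({1, 3, 5, 7} : Finset ℕ), ω j *
          g ((((j : ℝ) / 8) +ᵥ γ₀ • ((⟨64, by norm_num⟩ : {x : ℝ // 0 < x}) • w) : ℍ))) *
        (Complex.sqrt (8 * ((M : ℂ) * w + 1)) ^ (2 * k + 1))⁻¹) := by
    refine h1.congr_fun (fun n ↦ ?_)
    rw [← qParam_one_pow_eq_qParam_pow_mul hN₁ w n]
    field_simp
  have hinj : Function.Injective (fun n : ℕ ↦ n * N₁) := mul_left_injective₀ hN₁.ne'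
  rw [← hinj.hasSum_iff (fun K hK ↦ by
    rw [Set.mem_range, not_exists] at hK
    rw [if_neg (fun ⟨m, hm⟩ ↦ hK m (by rw [hm, mul_comm])), zero_mul])]
  refine h2.congr_fun (fun n ↦ ?_)
  simp only [Function.comp_apply]
  rw [if_pos (dvd_mul_left N₁ n), Nat.mul_div_cancel _ hN₁]

/-! ## §3 The EVEN part divided by the base is `¼`-periodic -/

/-- P1's base never vanishes: `√(8(Mw+1))^K ≠ 0` (`Mw + 1 ∈ ℍ ∪ {1}`). [folklore] -/
theorem csqrt_base_pow_ne_zero (M : ℕ) (w : ℍ) (K : ℕ) : Complex.sqrt (8 * ((M : ℂ) * w + 1)) ^ K ≠ 0 := by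
  have hbase : (M : ℂ) * w + 1 ≠ 0 := by
    rcases Nat.eq_zero_or_pos M with hM | hM
    · subst hM; simp
    · intro h0
      have h := congrArg Complex.im h0
      simp at h
      rcases h with h | h
      · omega
      · exact absurd h w.im_pos.ne'
  refine pow_ne_zero _ (fun h0 ↦ mul_ne_zero (by norm_num : (8 : ℂ) ≠ 0) hbase ?_)
  rw [← csqrt_sq (8 * ((M : ℂ) * w + 1)), h0]
  ring

/-- **THE JUNK IS `¼`-PERIODIC** (P3 `evenTranslate_flippedCusp_periodic`, divided by the two bases): for any weights `ω`,
`Σ_{j₁<4} ω(2j₁) g((2j₁)/8 +ᵥ γ₀•(64•(¼ +ᵥ w)))·(√(8(M(w+¼)+1))^K)⁻¹ = Σ_{j₁<4} ω(2j₁) g((2j₁)/8 +ᵥ γ₀•(64•w))·(√(8(Mw+1))^K)⁻¹`.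
[cite: Shimura1973HalfIntegral, §1, Prop. 1.5] -/
theorem junk_vadd_quarter {M : ℕ} {a b : ℤ} (ha : 0 ≤ a) (γ₀ : SL(2, ℤ))
    (h00 : (γ₀ 0 0 : ℤ) = a) (h01 : (γ₀ 0 1 : ℤ) = b) (h10 : (γ₀ 1 0 : ℤ) = M) (h11 : (γ₀ 1 1 : ℤ) = 64)
    {K : ℕ} {ψ : DirichletCharacter ℂ (4 * M)} {g : ℍ → ℂ}
    (hg : ∀ γ ∈ Gamma0 (4 * M), ∀ z : ℍ, g (γ • z) = autFactor K (4 * M) ψ γ z * g z) (ω : ℕ → ℂ) (w : ℍ) :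
    (∑ j₁ ∈ Finset.range 4, ω (2 * j₁) *
        g (((((2 * j₁ : ℕ) : ℝ) * 8⁻¹ : ℝ) +ᵥ γ₀ • ((⟨64, by norm_num⟩ : {x : ℝ // 0 < x}) • (((1 / 4 : ℝ) +ᵥ w) : ℍ)) : ℍ))) *
      (Complex.sqrt (8 * ((M : ℂ) * ((((1 / 4 : ℝ) +ᵥ w) : ℍ) : ℂ) + 1)) ^ K)⁻¹ =
    (∑ j₁ ∈ Finset.range 4, ω (2 * j₁) *
        g (((((2 * j₁ : ℕ) : ℝ) * 8⁻¹ : ℝ) +ᵥ γ₀ • ((⟨64, by norm_num⟩ : {x : ℝ // 0 < x}) • w) : ℍ))) *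
      (Complex.sqrt (8 * ((M : ℂ) * w + 1)) ^ K)⁻¹ := by
  have hS := csqrt_base_pow_ne_zero M w K
  have hS' := csqrt_base_pow_ne_zero M (((1 / 4 : ℝ) +ᵥ w) : ℍ) K
  rw [Finset.sum_mul, Finset.sum_mul]
  refine Finset.sum_congr rfl (fun j₁ _ ↦ ?_)
  have h := evenTranslate_flippedCusp_periodic ha γ₀ h00 h01 h10 h11 hg j₁ w
  have e8 : ((((2 * j₁ : ℕ) : ℝ) * 8⁻¹ : ℝ)) = (((2 * j₁ : ℕ) : ℝ) / 8) := by rw [div_eq_mul_inv]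
  rw [e8]
  rw [mul_assoc, mul_assoc]
  congr 1
  field_simp
  linear_combination h

/-! ## §4 The coefficients of the bracket at the frequencies `4 ∤ n` -/

/-- **THE BRACKET'S COEFFICIENTS OFF THE JUNK.** Let `γ₀ = [[a,b],[M,64]]` (`64a − Mb = 1`, `0 ≤ a`), `g` automorphic of weight `(2k+1)/2` on
`Γ₀(4M)` with `q`-expansion `b`, `c` a class mod `8`, `64 ∣ N`, and suppose w5 g8's bracket `B(z) = 8^{−(k+1)}·(P_c g)(γ₀•z)·(√((Mz+64)/8)^{2k+1})⁻¹`
has the expansion `B = Σ_m c_B(m) 𝕢_N^m` on `ℍ` (`…FlipRungTwoBracket.bracket_analytic_and_hasSum`). Then for every `n` with `4 ∤ n`: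
`c_B(n·N/64) = 8^{−(k+1)}·W_c(n)·b(n)`, `W_c(n) = Σ_{j∈{1,3,5,7}} ⅛ζ₈^{−cj}·ψ(8+Mj)·(ε_{8+Mj}⁻¹ J(8M|8+Mj))^{2k+1}·e(−jn/8)` (P1's raw flip weight;
T6a/P1b evaluate it as `(J(2|M)/8)·T(M(c+n) mod 8)`, a unit at every odd prime). Mechanism: `B(64•w) = MAIN(w) + JUNK(w)` with `MAIN` the odd
translates (§2) and `JUNK` the even ones (`¼`-periodic, §3); w5 g8's `coeff_eq_of_periodic_junk` with `H = N/64`, period `¼`.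
[cite: Shimura1973HalfIntegral, §1, Prop. 1.5] [cite: DiamondShurman2005, §1.1] -/
theorem bracket_coeff_eq_flipWeight_mul {M : ℕ} {a b : ℤ} (ha : 0 ≤ a) (hdet : 64 * a - (M : ℤ) * b = 1) (γ₀ : SL(2, ℤ))
    (h00 : (γ₀ 0 0 : ℤ) = a) (h01 : (γ₀ 0 1 : ℤ) = b) (h10 : (γ₀ 1 0 : ℤ) = M) (h11 : (γ₀ 1 1 : ℤ) = 64)
    {k : ℕ} {ψ : DirichletCharacter ℂ (4 * M)} {g : ℍ → ℂ}
    (hg : ∀ γ ∈ Gamma0 (4 * M), ∀ z : ℍ, g (γ • z) = autFactor (2 * k + 1) (4 * M) ψ γ z * g z)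
    {b' : ℕ → ℂ} (hb : ∀ τ : ℍ, HasSum (fun n ↦ b' n * Periodic.qParam 1 (τ : ℂ) ^ n) (g τ)) (c : ℕ)
    {N : ℕ} (hN : 64 ∣ N) (hN0 : 0 < N) {cB : ℕ → ℂ}
    (hB : ∀ z : ℍ, HasSum (fun m : ℕ ↦ cB m * Periodic.qParam (N : ℝ) (z : ℂ) ^ m)
      (((8 : ℂ)⁻¹) ^ (k + 1) * (classProj c g (γ₀ • z) * (Complex.sqrt (((M : ℂ) * z + 64) / 8) ^ (2 * k + 1))⁻¹)))
    (n : ℕ) (hn : ¬ 4 ∣ n) :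
    cB (n * (N / 64)) = ((8 : ℂ)⁻¹) ^ (k + 1) *
      (∑ j ∈ ({1, 3, 5, 7} : Finset ℕ), (8 : ℂ)⁻¹ * (zeta8 ^ (c * j))⁻¹ *
        (ψ (((8 + (M : ℤ) * (j : ℤ) : ℤ)) : ZMod (4 * M)) *
          ((thetaEps (8 + (M : ℤ) * (j : ℤ)))⁻¹ * (J(8 * (M : ℤ) | (8 + (M : ℤ) * (j : ℤ)).natAbs) : ℂ)) ^ (2 * k + 1)) *
        cexp (-(2 * π * Complex.I * ((j * n : ℕ) : ℂ) / 8))) * b' n := by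
  -- the period `H = N/64`
  set N₁ : ℕ := N / 64 with hN₁def
  have hNN₁ : N = 64 * N₁ := by rw [hN₁def]; exact (Nat.mul_div_cancel' hN).symm
  have hN₁ : 0 < N₁ := by
    rcases Nat.eq_zero_or_pos N₁ with h | h
    · rw [h] at hNN₁; omega
    · exact h
  -- the three functions of `w`
  set ω : ℕ → ℂ := fun j ↦ (8 : ℂ)⁻¹ * (zeta8 ^ (c * j))⁻¹ with hω
  set T : ℍ → ℂ := fun w ↦ ((8 : ℂ)⁻¹) ^ (k + 1) * (classProj c g (γ₀ • ((⟨64, by norm_num⟩ : {x : ℝ // 0 < x}) • w)) *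
    (Complex.sqrt (((M : ℂ) * ((((⟨64, by norm_num⟩ : {x : ℝ // 0 < x}) • w : ℍ)) : ℂ) + 64) / 8) ^ (2 * k + 1))⁻¹) with hT
  set MAIN : ℍ → ℂ := fun w ↦ ((8 : ℂ)⁻¹) ^ (k + 1) * (∑ j ∈ ({1, 3, 5, 7} : Finset ℕ), ω j *
      g ((((j : ℝ) / 8) +ᵥ γ₀ • ((⟨64, by norm_num⟩ : {x : ℝ // 0 < x}) • w) : ℍ))) *
    (Complex.sqrt (8 * ((M : ℂ) * w + 1)) ^ (2 * k + 1))⁻¹ with hMAIN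
  set JUNK : ℍ → ℂ := fun w ↦ ((8 : ℂ)⁻¹) ^ (k + 1) * (∑ j₁ ∈ Finset.range 4, ω (2 * j₁) *
      g (((((2 * j₁ : ℕ) : ℝ) * 8⁻¹ : ℝ) +ᵥ γ₀ • ((⟨64, by norm_num⟩ : {x : ℝ // 0 < x}) • w) : ℍ))) *
    (Complex.sqrt (8 * ((M : ℂ) * w + 1)) ^ (2 * k + 1))⁻¹ with hJUNK
  -- (1) `T = MAIN + JUNK`
  have hsplit : ∀ w : ℍ, T w = MAIN w + JUNK w := by
    intro w
    simp only [hT, hMAIN, hJUNK]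
    rw [bracketBase_dilate, classProj_apply, sum_range_eight_split]
    have e8 : ∀ j : ℕ, g ((((j : ℝ) * 8⁻¹ : ℝ)) +ᵥ γ₀ • ((⟨64, by norm_num⟩ : {x : ℝ // 0 < x}) • w) : ℍ) =
        g ((((j : ℝ) / 8) +ᵥ γ₀ • ((⟨64, by norm_num⟩ : {x : ℝ // 0 < x}) • w) : ℍ)) := fun j ↦ by rw [div_eq_mul_inv]
    have hodd : ∑ j ∈ ({1, 3, 5, 7} : Finset ℕ), (8 : ℂ)⁻¹ * (zeta8 ^ (c * j))⁻¹ *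
        g ((((j : ℝ) * 8⁻¹ : ℝ)) +ᵥ γ₀ • ((⟨64, by norm_num⟩ : {x : ℝ // 0 < x}) • w) : ℍ) =
        ∑ j ∈ ({1, 3, 5, 7} : Finset ℕ), ω j * g ((((j : ℝ) / 8) +ᵥ γ₀ • ((⟨64, by norm_num⟩ : {x : ℝ // 0 < x}) • w) : ℍ)) :=
      Finset.sum_congr rfl (fun j _ ↦ by rw [e8 j])
    rw [hodd]
    ring
  -- (2) the expansion of `T` in `𝕢_{N₁}(w)`
  have hTsum : ∀ w : ℍ, HasSum (fun K : ℕ ↦ cB K * Periodic.qParam (N₁ : ℝ) (w : ℂ) ^ K) (T w) := by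
    intro w
    have h := hB ((⟨64, by norm_num⟩ : {x : ℝ // 0 < x}) • w)
    simp_rw [qParam_dilate_eq hN w] at h
    exact h
  -- (3) the expansion of `MAIN` and the periodicity of `JUNK`
  have hMsum := fun w : ℍ ↦ hasSum_main_qParam hdet γ₀ h00 h01 h10 h11 hg ω hb hN₁ w
  have hJ : ∀ w : ℍ, JUNK (((1 / 4 : ℝ) +ᵥ w) : ℍ) = JUNK w := by
    intro w
    simp only [hJUNK]
    rw [mul_assoc, junk_vadd_quarter ha γ₀ h00 h01 h10 h11 hg ω w, ← mul_assoc]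
  -- (4) the generic coefficient lemma
  have hH : (0 : ℝ) < (N₁ : ℝ) := by exact_mod_cast hN₁
  have hK : cexp (2 * π * Complex.I * (1 / 4 : ℝ) / (N₁ : ℝ) * ((n * N₁ : ℕ) : ℂ)) ≠ 1 := by
    have h := cexp_two_pi_I_mul_div_ne_one (by norm_num : 0 < 4) hn
    have hN₁C : (N₁ : ℂ) ≠ 0 := by exact_mod_cast hN₁.ne'
    have e : (2 * π * Complex.I * (1 / 4 : ℝ) / (N₁ : ℝ) * ((n * N₁ : ℕ) : ℂ) : ℂ) =
        2 * π * Complex.I * ((n : ℂ) / ((4 : ℕ) : ℂ)) := by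
      push_cast
      field_simp
    rwa [e]
  have hmain := coeff_eq_of_periodic_junk hH (1 / 4) hsplit hTsum hMsum hJ (n * N₁) hK
  rw [hmain, if_pos (dvd_mul_left N₁ n), Nat.mul_div_cancel _ hN₁]

end Summit.BirchSwinnertonDyer.BirchSwinnertonDyer.Theorems.PrintCFram.FlipRung

end
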